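import Summits.Ventures.YMGap.Thresholds.OneLinkPsiTwoGradient
import HarnessLib

/-!
# Venture YMGap — the one-link modulus beyond first order, part 12: pointwise derivative bounds for the WORDS of the cubic
# remainder (imaginary parts, quadratic × linear products, linear × constant) on `SU(N)`

HONEST FRAMING: venture file of the cell `pub-ymgap` (QuantumFields programme), strong-coupling LATTICE bookkeeping for `SU(N)`
lattice Yang–Mills; nothing about the continuum or the mass gap in the Clay sense.  Pure matrix calculus («F5», part 2b-ii, of the
cell note `HOME/p2/ONE-LINK-HIERARCHY.md` §4 (4.6)); no measure, no number of record.

WHAT.  The cubic remainder `c₃ = Γ(Re tr(·B), ψ₂)` is, on `SU(N)`, an explicit eight-term trace polynomial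
(`OneLinkRemainderIdentity.gam_potB_psiTwo_eq`).  This file bounds the left-invariant derivative `D_A` of each non-cubic word
shape at `g ∈ SU(N)`, for every ambient direction `A ∈ M_N(ℂ)` (the cubic words are `OneLinkCubicWords`):
* `matD_imTrMul`, `matD_imTrQuad`: derivatives of `Im tr(QM)` and `Im tr(QM₁QM₂)`;
* `abs_matD_quad_eta_le`: `|D_A Re[tr(QM₁QM₂)(κ tr(QM) − c conj tr(QM))]| ≤ (κ+c)((‖M₁gM₂‖_F + ‖M₂gM₁‖_F)‖tr(gM)‖ + ‖tr(gM₁gM₂)‖‖M‖_F)‖A‖_F`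
  — the COMPLEX product rule (no factor-2 loss from splitting real and imaginary parts);
* `abs_matD_im_mul_imQuad_le`: `|D_A [Im tr(QB) Im tr(QΔQB)]| ≤ (2‖B‖_op‖Δ‖_F|Im tr(gB)| + ‖B‖_F‖tr(gΔgB)‖)‖A‖_F`;
* `abs_matD_im_mul_imProd_le`: `|D_A [Im tr(QB) Im(tr(QB)tr(QΔ))]| ≤ (|Im tr(gB)|(‖B‖_F‖tr(gΔ)‖ + ‖Δ‖_F‖tr(gB)‖) + ‖B‖_F‖tr(gB)‖‖tr(gΔ)‖)‖A‖_F`;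
* `abs_matD_lin_const_le`: `|D_A Re[tr(QM) ζ]| ≤ ‖M‖_F‖ζ‖‖A‖_F`;  `abs_matD_linB_le`: `|D_A[Re tr(QBBᴴΔ) + Re tr(QΔBᴴB)]| ≤ 2‖B‖_op²‖Δ‖_F‖A‖_F`.

References: cell note `HOME/p2/ONE-LINK-HIERARCHY.md` §4 (4.6), `HOME/p2/hier/LEAN-SPEC-REMAINING.md` F5.2b.
-/

noncomputable section

open scoped Matrix ComplexConjugate BigOperators
open Matrix Complex Finset
open Literature.MathematicalPhysics.QuantumFieldTheory
open Literature.MathematicalPhysics.QuantumFieldTheory.SUNBakryEmery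

namespace Summit.Ventures.YMGap.OneLinkEigen

variable {N : ℕ}

section Calc

open scoped Matrix.Norms.Frobenius ContDiff Topology

/-! ### Imaginary parts of the linear and quadratic words -/

/-- `Im tr(QM) = Re tr(Q(−iM))` as functions. [folklore] -/
theorem imTrMul_eq (M : Matrix (Fin N) (Fin N) ℂ) :
    (fun Q : Matrix (Fin N) (Fin N) ℂ => (Q * M).trace.im) = fun Q => (Q * ((-I) • M)).trace.re :=
  funext fun Q => (re_trace_mul_negI_smul Q M).symm

/-- `Q ↦ Im tr(QM)` is smooth. [folklore] -/
theorem contDiff_imTrMul (M : Matrix (Fin N) (Fin N) ℂ) :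
    ContDiff ℝ ∞ fun Q : Matrix (Fin N) (Fin N) ℂ => (Q * M).trace.im := by
  rw [imTrMul_eq]; exact contDiff_reTrMul _

/-- `D_A Im tr(QM) = Im tr(QAM)`. [folklore] -/
theorem matD_imTrMul (A M : Matrix (Fin N) (Fin N) ℂ) :
    matD A (fun Q : Matrix (Fin N) (Fin N) ℂ => (Q * M).trace.im) = fun Q => (Q * A * M).trace.im := by
  rw [imTrMul_eq, matD_reTrMul]
  funext Q
  exact re_trace_mul_negI_smul (Q * A) M

/-- `Im tr(QM₁QM₂) = Re tr(QM₁Q(−iM₂))` as functions. [folklore] -/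
theorem imTrQuad_eq (M₁ M₂ : Matrix (Fin N) (Fin N) ℂ) :
    (fun Q : Matrix (Fin N) (Fin N) ℂ => (Q * M₁ * Q * M₂).trace.im) = fun Q => (Q * M₁ * Q * ((-I) • M₂)).trace.re :=
  funext fun Q => (re_trace_mul_negI_smul (Q * M₁ * Q) M₂).symm

/-- `Q ↦ Im tr(QM₁QM₂)` is smooth. [folklore] -/
theorem contDiff_imTrQuad (M₁ M₂ : Matrix (Fin N) (Fin N) ℂ) :
    ContDiff ℝ ∞ fun Q : Matrix (Fin N) (Fin N) ℂ => (Q * M₁ * Q * M₂).trace.im := by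
  rw [imTrQuad_eq]; exact contDiff_reTrQuad _ _

/-- `D_A Im tr(QM₁QM₂) = Im tr(QAM₁QM₂) + Im tr(QM₁QAM₂)`. [folklore] -/
theorem matD_imTrQuad (A M₁ M₂ : Matrix (Fin N) (Fin N) ℂ) :
    matD A (fun Q : Matrix (Fin N) (Fin N) ℂ => (Q * M₁ * Q * M₂).trace.im) =
      fun Q => (Q * A * M₁ * Q * M₂).trace.im + (Q * M₁ * Q * A * M₂).trace.im := by
  rw [imTrQuad_eq, matD_reTrQuad]
  funext Q
  rw [re_trace_mul_negI_smul (Q * A * M₁ * Q) M₂, re_trace_mul_negI_smul (Q * M₁ * Q * A) M₂]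

/-! ### Norm bookkeeping -/

/-- The complex derivative of the quadratic word: `‖tr(gAM₁gM₂) + tr(gM₁gAM₂)‖ ≤ (‖M₁gM₂‖_F + ‖M₂gM₁‖_F)‖A‖_F` on `SU(N)`.
[folklore] -/
theorem norm_dQuad_le (A M₁ M₂ : Matrix (Fin N) (Fin N) ℂ) (g : SUN N) :
    ‖((g : Matrix (Fin N) (Fin N) ℂ) * A * M₁ * g * M₂).trace + ((g : Matrix (Fin N) (Fin N) ℂ) * M₁ * g * A * M₂).trace‖ ≤
      (frobNorm (M₁ * (g : Matrix (Fin N) (Fin N) ℂ) * M₂) + frobNorm (M₂ * (g : Matrix (Fin N) (Fin N) ℂ) * M₁)) * frobNorm A := by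
  have hg := SUN.mem_unitaryGroup g
  set Q : Matrix (Fin N) (Fin N) ℂ := (g : Matrix (Fin N) (Fin N) ℂ) with hQ
  have h1 : ‖(Q * A * M₁ * Q * M₂).trace‖ ≤ frobNorm A * frobNorm (M₁ * Q * M₂) := by
    rw [show Q * A * M₁ * Q * M₂ = (Q * A) * (M₁ * Q * M₂) by simp only [Matrix.mul_assoc]]
    refine (norm_trace_mul_le _ _).trans ?_
    rw [frobNorm_unitary_mul hg]
  have h2 : ‖(Q * M₁ * Q * A * M₂).trace‖ ≤ frobNorm A * frobNorm (M₂ * Q * M₁) := by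
    rw [show Q * M₁ * Q * A * M₂ = (Q * M₁) * (Q * A * M₂) by simp only [Matrix.mul_assoc], trace_mul_comm,
      show Q * A * M₂ * (Q * M₁) = (Q * A) * (M₂ * Q * M₁) by simp only [Matrix.mul_assoc]]
    refine (norm_trace_mul_le _ _).trans ?_
    rw [frobNorm_unitary_mul hg]
  calc _ ≤ ‖(Q * A * M₁ * Q * M₂).trace‖ + ‖(Q * M₁ * Q * A * M₂).trace‖ := norm_add_le _ _
    _ ≤ frobNorm A * frobNorm (M₁ * Q * M₂) + frobNorm A * frobNorm (M₂ * Q * M₁) := add_le_add h1 h2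
    _ = _ := by ring

/-- `‖B g M‖_F ≤ ‖B‖_op ‖M‖_F` on `SU(N)`. [folklore] -/
theorem frobNorm_BgM_le (B M : Matrix (Fin N) (Fin N) ℂ) (g : SUN N) :
    frobNorm (B * (g : Matrix (Fin N) (Fin N) ℂ) * M) ≤ matrixOpNorm B * frobNorm M := by
  rw [Matrix.mul_assoc]
  refine (frobNorm_mul_le_matrixOpNorm_mul _ _).trans ?_
  rw [frobNorm_unitary_mul (SUN.mem_unitaryGroup g)]

/-- `‖M g B‖_F ≤ ‖M‖_F ‖B‖_op` on `SU(N)`. [folklore] -/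
theorem frobNorm_MgB_le (M B : Matrix (Fin N) (Fin N) ℂ) (g : SUN N) :
    frobNorm (M * (g : Matrix (Fin N) (Fin N) ℂ) * B) ≤ frobNorm M * matrixOpNorm B := by
  refine (frobNorm_mul_le_mul_matrixOpNorm _ _).trans ?_
  rw [frobNorm_mul_unitary _ (SUN.mem_unitaryGroup g)]

/-- `‖κ z − c conj z‖ ≤ (κ + c)‖z‖` for `κ, c ≥ 0`. [folklore] -/
theorem norm_kappa_sub_conj_le {κ c : ℝ} (hκ : 0 ≤ κ) (hc : 0 ≤ c) (z : ℂ) :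
    ‖(κ : ℂ) * z - (c : ℂ) * (starRingEnd ℂ) z‖ ≤ (κ + c) * ‖z‖ := by
  calc _ ≤ ‖(κ : ℂ) * z‖ + ‖(c : ℂ) * (starRingEnd ℂ) z‖ := norm_sub_le _ _
    _ = (κ + c) * ‖z‖ := by
        rw [norm_mul, norm_mul, Complex.norm_real, Complex.norm_real, Complex.norm_conj, Real.norm_of_nonneg hκ,
          Real.norm_of_nonneg hc]
        ring

/-- `|Im z| ≤ ‖z‖`. [folklore] -/
theorem abs_im_le_norm' (z : ℂ) : |z.im| ≤ ‖z‖ := Complex.abs_im_le_norm z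

/-! ### Quadratic word × linear combination of a linear statistic and its conjugate -/

/-- **Complex product rule for `Re[tr(QM₁QM₂)·(κ tr(QM) − c conj tr(QM))]`** on `SU(N)` (`κ, c ≥ 0`):
`|D_A(…)(g)| ≤ (κ + c)((‖M₁gM₂‖_F + ‖M₂gM₁‖_F)‖tr(gM)‖ + ‖tr(gM₁gM₂)‖‖M‖_F)‖A‖_F`. [folklore] -/
theorem abs_matD_quad_eta_le {κ c : ℝ} (hκ : 0 ≤ κ) (hc : 0 ≤ c) (A M₁ M₂ M : Matrix (Fin N) (Fin N) ℂ) (g : SUN N) :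
    |matD A (fun Q : Matrix (Fin N) (Fin N) ℂ =>
        ((Q * M₁ * Q * M₂).trace * ((κ : ℂ) * (Q * M).trace - (c : ℂ) * (starRingEnd ℂ) (Q * M).trace)).re) g| ≤
      (κ + c) * ((frobNorm (M₁ * (g : Matrix (Fin N) (Fin N) ℂ) * M₂) + frobNorm (M₂ * (g : Matrix (Fin N) (Fin N) ℂ) * M₁)) *
          ‖((g : Matrix (Fin N) (Fin N) ℂ) * M).trace‖
        + ‖((g : Matrix (Fin N) (Fin N) ℂ) * M₁ * g * M₂).trace‖ * frobNorm M) * frobNorm A := by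
  set Q : Matrix (Fin N) (Fin N) ℂ := (g : Matrix (Fin N) (Fin N) ℂ) with hQ
  -- real form of the function
  have hF : (fun Q : Matrix (Fin N) (Fin N) ℂ =>
        ((Q * M₁ * Q * M₂).trace * ((κ : ℂ) * (Q * M).trace - (c : ℂ) * (starRingEnd ℂ) (Q * M).trace)).re) =
      fun Q => (κ - c) * ((Q * M₁ * Q * M₂).trace.re * (Q * M).trace.re)
        + (-(κ + c)) * ((Q * M₁ * Q * M₂).trace.im * (Q * M).trace.im) := by
    funext Q
    simp only [mul_re, sub_re, sub_im, mul_im, conj_re, conj_im, ofReal_re, ofReal_im]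
    ring
  have hwr := contDiff_reTrQuad (N := N) M₁ M₂
  have hwi := contDiff_imTrQuad (N := N) M₁ M₂
  have hzr := contDiff_reTrMul (N := N) M
  have hzi := contDiff_imTrMul (N := N) M
  have hp1 : ContDiff ℝ ∞ fun Q : Matrix (Fin N) (Fin N) ℂ => (Q * M₁ * Q * M₂).trace.re * (Q * M).trace.re := hwr.mul hzr
  have hp2 : ContDiff ℝ ∞ fun Q : Matrix (Fin N) (Fin N) ℂ => (Q * M₁ * Q * M₂).trace.im * (Q * M).trace.im := hwi.mul hzi
  have h1 : ContDiff ℝ ∞ fun Q : Matrix (Fin N) (Fin N) ℂ => (κ - c) * ((Q * M₁ * Q * M₂).trace.re * (Q * M).trace.re) :=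
    contDiff_const.mul hp1
  have h2 : ContDiff ℝ ∞ fun Q : Matrix (Fin N) (Fin N) ℂ => (-(κ + c)) * ((Q * M₁ * Q * M₂).trace.im * (Q * M).trace.im) :=
    contDiff_const.mul hp2
  rw [hF, matD_fun_add h1 h2, matD_const_mul hp1, matD_const_mul hp2, matD_fun_mul hwr hzr, matD_fun_mul hwi hzi,
    matD_reTrQuad, matD_imTrQuad, matD_reTrMul, matD_imTrMul]
  simp only []
  -- the complex bookkeeping
  set W : ℂ := (Q * M₁ * Q * M₂).trace with hW
  set dW : ℂ := (Q * A * M₁ * Q * M₂).trace + (Q * M₁ * Q * A * M₂).trace with hdW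
  set z : ℂ := (Q * M).trace with hz
  set dz : ℂ := (Q * A * M).trace with hdz
  have e : (κ - c) * (W.re * dz.re + z.re * ((Q * A * M₁ * Q * M₂).trace.re + (Q * M₁ * Q * A * M₂).trace.re))
        + (-(κ + c)) * (W.im * dz.im + z.im * ((Q * A * M₁ * Q * M₂).trace.im + (Q * M₁ * Q * A * M₂).trace.im)) =
      (dW * ((κ : ℂ) * z - (c : ℂ) * (starRingEnd ℂ) z)).re + (W * ((κ : ℂ) * dz - (c : ℂ) * (starRingEnd ℂ) dz)).re := by
    simp only [hdW, mul_re, add_re, add_im, sub_re, sub_im, mul_im, conj_re, conj_im, ofReal_re, ofReal_im]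
    ring
  rw [e]
  have hA := frobNorm_nonneg A
  have hκc : 0 ≤ κ + c := add_nonneg hκ hc
  have b1 : ‖dW‖ ≤ (frobNorm (M₁ * Q * M₂) + frobNorm (M₂ * Q * M₁)) * frobNorm A := norm_dQuad_le A M₁ M₂ g
  have b2 : ‖(κ : ℂ) * z - (c : ℂ) * (starRingEnd ℂ) z‖ ≤ (κ + c) * ‖z‖ := norm_kappa_sub_conj_le hκ hc z
  have b3 : ‖(κ : ℂ) * dz - (c : ℂ) * (starRingEnd ℂ) dz‖ ≤ (κ + c) * (frobNorm A * frobNorm M) :=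
    (norm_kappa_sub_conj_le hκ hc dz).trans (mul_le_mul_of_nonneg_left (norm_trace_su_mul_mul_le g A M) hκc)
  calc _ ≤ |(dW * ((κ : ℂ) * z - (c : ℂ) * (starRingEnd ℂ) z)).re| + |(W * ((κ : ℂ) * dz - (c : ℂ) * (starRingEnd ℂ) dz)).re| :=
        abs_add_le _ _
    _ ≤ ‖dW‖ * ‖(κ : ℂ) * z - (c : ℂ) * (starRingEnd ℂ) z‖ + ‖W‖ * ‖(κ : ℂ) * dz - (c : ℂ) * (starRingEnd ℂ) dz‖ :=
        add_le_add (abs_re_mul_le_norm_mul_norm _ _) (abs_re_mul_le_norm_mul_norm _ _)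
    _ ≤ ((frobNorm (M₁ * Q * M₂) + frobNorm (M₂ * Q * M₁)) * frobNorm A) * ((κ + c) * ‖z‖)
          + ‖W‖ * ((κ + c) * (frobNorm A * frobNorm M)) :=
        add_le_add (mul_le_mul b1 b2 (norm_nonneg _) (mul_nonneg (add_nonneg (frobNorm_nonneg _) (frobNorm_nonneg _)) hA))
          (mul_le_mul_of_nonneg_left b3 (norm_nonneg _))
    _ = _ := by ring

/-! ### Products with the imaginary part of the weight statistic -/

/-- **`|D_A [Im tr(QB) · Im tr(QΔQB)](g)| ≤ (2‖B‖_op‖Δ‖_F |Im tr(gB)| + ‖B‖_F ‖tr(gΔgB)‖) ‖A‖_F`** on `SU(N)`. [folklore] -/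
theorem abs_matD_im_mul_imQuad_le (A B Δ : Matrix (Fin N) (Fin N) ℂ) (g : SUN N) :
    |matD A (fun Q : Matrix (Fin N) (Fin N) ℂ => (Q * B).trace.im * (Q * Δ * Q * B).trace.im) g| ≤
      (2 * matrixOpNorm B * frobNorm Δ * |((g : Matrix (Fin N) (Fin N) ℂ) * B).trace.im|
        + frobNorm B * ‖((g : Matrix (Fin N) (Fin N) ℂ) * Δ * g * B).trace‖) * frobNorm A := by
  set Q : Matrix (Fin N) (Fin N) ℂ := (g : Matrix (Fin N) (Fin N) ℂ) with hQ
  have hX := contDiff_imTrMul (N := N) B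
  have hw := contDiff_imTrQuad (N := N) Δ B
  rw [matD_fun_mul hX hw, matD_imTrMul, matD_imTrQuad]
  simp only []
  set dW : ℂ := (Q * A * Δ * Q * B).trace + (Q * Δ * Q * A * B).trace with hdW
  have e : (Q * A * Δ * Q * B).trace.im + (Q * Δ * Q * A * B).trace.im = dW.im := by rw [hdW, add_im]
  rw [e]
  have hA := frobNorm_nonneg A
  have b1 : ‖dW‖ ≤ 2 * matrixOpNorm B * frobNorm Δ * frobNorm A := by
    refine (norm_dQuad_le A Δ B g).trans ?_
    have h1 := frobNorm_MgB_le Δ B g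
    have h2 := frobNorm_BgM_le B Δ g
    nlinarith
  have b2 : |dW.im| ≤ ‖dW‖ := abs_im_le_norm' dW
  have b3 : |(Q * A * B).trace.im| ≤ frobNorm A * frobNorm B := (abs_im_le_norm' _).trans (norm_trace_su_mul_mul_le g A B)
  have b4 : |(Q * Δ * Q * B).trace.im| ≤ ‖(Q * Δ * Q * B).trace‖ := abs_im_le_norm' _
  calc |(Q * B).trace.im * dW.im + (Q * Δ * Q * B).trace.im * (Q * A * B).trace.im|
      ≤ |(Q * B).trace.im| * |dW.im| + |(Q * Δ * Q * B).trace.im| * |(Q * A * B).trace.im| := by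
        refine (abs_add_le _ _).trans ?_; rw [abs_mul, abs_mul]
    _ ≤ |(Q * B).trace.im| * (2 * matrixOpNorm B * frobNorm Δ * frobNorm A)
          + ‖(Q * Δ * Q * B).trace‖ * (frobNorm A * frobNorm B) :=
        add_le_add (mul_le_mul_of_nonneg_left (b2.trans b1) (abs_nonneg _))
          (mul_le_mul b4 b3 (abs_nonneg _) (norm_nonneg _))
    _ = _ := by ring

/-- **`|D_A [Im tr(QB) · Im(tr(QB) tr(QΔ))](g)| ≤ (|Im tr(gB)|(‖B‖_F‖tr(gΔ)‖ + ‖Δ‖_F‖tr(gB)‖) + ‖B‖_F‖tr(gB)‖‖tr(gΔ)‖) ‖A‖_F`**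
on `SU(N)`. [folklore] -/
theorem abs_matD_im_mul_imProd_le (A B Δ : Matrix (Fin N) (Fin N) ℂ) (g : SUN N) :
    |matD A (fun Q : Matrix (Fin N) (Fin N) ℂ => (Q * B).trace.im * ((Q * B).trace * (Q * Δ).trace).im) g| ≤
      (|((g : Matrix (Fin N) (Fin N) ℂ) * B).trace.im| *
          (frobNorm B * ‖((g : Matrix (Fin N) (Fin N) ℂ) * Δ).trace‖ + frobNorm Δ * ‖((g : Matrix (Fin N) (Fin N) ℂ) * B).trace‖)
        + frobNorm B * ‖((g : Matrix (Fin N) (Fin N) ℂ) * B).trace‖ * ‖((g : Matrix (Fin N) (Fin N) ℂ) * Δ).trace‖) * frobNorm A := by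
  set Q : Matrix (Fin N) (Fin N) ℂ := (g : Matrix (Fin N) (Fin N) ℂ) with hQ
  have hF : (fun Q : Matrix (Fin N) (Fin N) ℂ => (Q * B).trace.im * ((Q * B).trace * (Q * Δ).trace).im) =
      fun Q => (Q * B).trace.im * ((Q * B).trace.re * (Q * Δ).trace.im + (Q * B).trace.im * (Q * Δ).trace.re) := by
    funext Q; simp only [mul_im]
  have hBr := contDiff_reTrMul (N := N) B
  have hBi := contDiff_imTrMul (N := N) B
  have hΔr := contDiff_reTrMul (N := N) Δ
  have hΔi := contDiff_imTrMul (N := N) Δ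
  have hq1 : ContDiff ℝ ∞ fun Q : Matrix (Fin N) (Fin N) ℂ => (Q * B).trace.re * (Q * Δ).trace.im := hBr.mul hΔi
  have hq2 : ContDiff ℝ ∞ fun Q : Matrix (Fin N) (Fin N) ℂ => (Q * B).trace.im * (Q * Δ).trace.re := hBi.mul hΔr
  have hin : ContDiff ℝ ∞ fun Q : Matrix (Fin N) (Fin N) ℂ =>
      (Q * B).trace.re * (Q * Δ).trace.im + (Q * B).trace.im * (Q * Δ).trace.re := hq1.add hq2
  rw [hF, matD_fun_mul hBi hin, matD_fun_add hq1 hq2, matD_fun_mul hBr hΔi, matD_fun_mul hBi hΔr, matD_reTrMul,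
    matD_imTrMul, matD_imTrMul, matD_reTrMul]
  simp only []
  set z₁ : ℂ := (Q * B).trace with hz₁
  set z₂ : ℂ := (Q * Δ).trace with hz₂
  set d₁ : ℂ := (Q * A * B).trace with hd₁
  set d₂ : ℂ := (Q * A * Δ).trace with hd₂
  have e1 : z₁.re * d₂.im + z₂.im * d₁.re + (z₁.im * d₂.re + z₂.re * d₁.im) = (d₁ * z₂).im + (z₁ * d₂).im := by
    simp only [mul_im]; ring
  have e2 : z₁.re * z₂.im + z₁.im * z₂.re = (z₁ * z₂).im := by rw [mul_im]
  rw [e1, e2]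
  have hA := frobNorm_nonneg A
  have b1 : |(d₁ * z₂).im + (z₁ * d₂).im| ≤ frobNorm A * frobNorm B * ‖z₂‖ + ‖z₁‖ * (frobNorm A * frobNorm Δ) := by
    refine (abs_add_le _ _).trans (add_le_add ?_ ?_)
    · refine (abs_im_le_norm' _).trans ?_
      rw [norm_mul]
      exact mul_le_mul_of_nonneg_right (norm_trace_su_mul_mul_le g A B) (norm_nonneg _)
    · refine (abs_im_le_norm' _).trans ?_
      rw [norm_mul]
      exact mul_le_mul_of_nonneg_left (norm_trace_su_mul_mul_le g A Δ) (norm_nonneg _)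
  have b2 : |(z₁ * z₂).im| ≤ ‖z₁‖ * ‖z₂‖ := (abs_im_le_norm' _).trans (norm_mul_le _ _)
  have b3 : |d₁.im| ≤ frobNorm A * frobNorm B := (abs_im_le_norm' _).trans (norm_trace_su_mul_mul_le g A B)
  calc |z₁.im * ((d₁ * z₂).im + (z₁ * d₂).im) + (z₁ * z₂).im * d₁.im|
      ≤ |z₁.im| * |(d₁ * z₂).im + (z₁ * d₂).im| + |(z₁ * z₂).im| * |d₁.im| := by
        refine (abs_add_le _ _).trans ?_; rw [abs_mul, abs_mul]
    _ ≤ |z₁.im| * (frobNorm A * frobNorm B * ‖z₂‖ + ‖z₁‖ * (frobNorm A * frobNorm Δ))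
          + ‖z₁‖ * ‖z₂‖ * (frobNorm A * frobNorm B) :=
        add_le_add (mul_le_mul_of_nonneg_left b1 (abs_nonneg _)) (mul_le_mul b2 b3 (abs_nonneg _) (by positivity))
    _ = _ := by ring

/-! ### Linear words -/

/-- **`|D_A Re[tr(QM) ζ](g)| ≤ ‖M‖_F ‖ζ‖ ‖A‖_F`** on `SU(N)`. [folklore] -/
theorem abs_matD_lin_const_le (A M : Matrix (Fin N) (Fin N) ℂ) (ζ : ℂ) (g : SUN N) :
    |matD A (fun Q : Matrix (Fin N) (Fin N) ℂ => ((Q * M).trace * ζ).re) g| ≤ frobNorm M * ‖ζ‖ * frobNorm A := by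
  set Q : Matrix (Fin N) (Fin N) ℂ := (g : Matrix (Fin N) (Fin N) ℂ) with hQ
  have hF : (fun Q : Matrix (Fin N) (Fin N) ℂ => ((Q * M).trace * ζ).re) =
      fun Q => ζ.re * (Q * M).trace.re + (-ζ.im) * (Q * M).trace.im := by
    funext Q; simp only [mul_re]; ring
  have hr := contDiff_reTrMul (N := N) M
  have hi := contDiff_imTrMul (N := N) M
  have h1 : ContDiff ℝ ∞ fun Q : Matrix (Fin N) (Fin N) ℂ => ζ.re * (Q * M).trace.re := contDiff_const.mul hr
  have h2 : ContDiff ℝ ∞ fun Q : Matrix (Fin N) (Fin N) ℂ => (-ζ.im) * (Q * M).trace.im := contDiff_const.mul hi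
  rw [hF, matD_fun_add h1 h2, matD_const_mul hr, matD_const_mul hi, matD_reTrMul, matD_imTrMul]
  simp only []
  have e : ζ.re * (Q * A * M).trace.re + (-ζ.im) * (Q * A * M).trace.im = ((Q * A * M).trace * ζ).re := by
    simp only [mul_re]; ring
  rw [e]
  refine (abs_re_mul_le_norm_mul_norm _ _).trans ?_
  have h := norm_trace_su_mul_mul_le g A M
  calc ‖(Q * A * M).trace‖ * ‖ζ‖ ≤ (frobNorm A * frobNorm M) * ‖ζ‖ := mul_le_mul_of_nonneg_right h (norm_nonneg _)
    _ = _ := by ring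

/-- **`|D_A [Re tr(Q BBᴴΔ) + Re tr(Q ΔBᴴB)](g)| ≤ 2 ‖B‖_op² ‖Δ‖_F ‖A‖_F`** on `SU(N)`. [folklore] -/
theorem abs_matD_linB_le (A B Δ : Matrix (Fin N) (Fin N) ℂ) (g : SUN N) :
    |matD A (fun Q : Matrix (Fin N) (Fin N) ℂ => (Q * (B * Bᴴ * Δ)).trace.re + (Q * (Δ * Bᴴ * B)).trace.re) g| ≤
      2 * matrixOpNorm B ^ 2 * frobNorm Δ * frobNorm A := by
  set Q : Matrix (Fin N) (Fin N) ℂ := (g : Matrix (Fin N) (Fin N) ℂ) with hQ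
  have h1 := contDiff_reTrMul (N := N) (B * Bᴴ * Δ)
  have h2 := contDiff_reTrMul (N := N) (Δ * Bᴴ * B)
  rw [matD_fun_add h1 h2, matD_reTrMul, matD_reTrMul]
  simp only []
  have hB0 := matrixOpNorm_nonneg B
  have hA := frobNorm_nonneg A
  have n1 : frobNorm (B * Bᴴ * Δ) ≤ matrixOpNorm B ^ 2 * frobNorm Δ := by
    rw [Matrix.mul_assoc]
    refine (frobNorm_mul_le_matrixOpNorm_mul _ _).trans ?_
    have h := frobNorm_mul_le_matrixOpNorm_mul Bᴴ Δ
    rw [matrixOpNorm_conjTranspose] at h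
    nlinarith [mul_le_mul_of_nonneg_left h hB0]
  have n2 : frobNorm (Δ * Bᴴ * B) ≤ matrixOpNorm B ^ 2 * frobNorm Δ := by
    refine (frobNorm_mul_le_mul_matrixOpNorm _ _).trans ?_
    have h := frobNorm_mul_le_mul_matrixOpNorm Δ Bᴴ
    rw [matrixOpNorm_conjTranspose] at h
    nlinarith [mul_le_mul_of_nonneg_right h hB0]
  have t1 : |(Q * A * (B * Bᴴ * Δ)).trace.re| ≤ frobNorm A * (matrixOpNorm B ^ 2 * frobNorm Δ) := by
    refine (Complex.abs_re_le_norm _).trans ((norm_trace_su_mul_mul_le g A _).trans ?_)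
    exact mul_le_mul_of_nonneg_left n1 hA
  have t2 : |(Q * A * (Δ * Bᴴ * B)).trace.re| ≤ frobNorm A * (matrixOpNorm B ^ 2 * frobNorm Δ) := by
    refine (Complex.abs_re_le_norm _).trans ((norm_trace_su_mul_mul_le g A _).trans ?_)
    exact mul_le_mul_of_nonneg_left n2 hA
  calc _ ≤ |(Q * A * (B * Bᴴ * Δ)).trace.re| + |(Q * A * (Δ * Bᴴ * B)).trace.re| := abs_add_le _ _
    _ ≤ _ := by nlinarith

end Calc

end Summit.Ventures.YMGap.OneLinkEigen
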